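import Literature.NumberTheory.Automorphic.HarishChandraDiracGL
import Literature.NumberTheory.Automorphic.HarishChandraConvolutionAdelic
import Literature.NumberTheory.Automorphic.AutomorphicFormsStableConvolution
import HarnessLib

/-!
# Right convolution of automorphic forms on `GL_n(𝔸_K)` by test functions on `GL_n(K_∞)`:
# the calculus (derivatives fall on the weight, growth keeps its exponent, `K_∞` commutes)

Topic `NumberTheory/Automorphic`. For a function `φ` on `GL_n(𝔸_K)`, a measure `ν` on
`G_∞ = GL_n(K_∞)` and a weight `α : G_∞ → ℂ`, Borel's right convolution is
`(φ ∗ α)(g) = ∫_{G_∞} φ(g x) α(x⁻¹) dν(x)` (`archConv ν α φ`; Borel 1997, 2.2: `(f ∗ α)(x) =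
∫ f(xy) α(y⁻¹) dy`). This file proves the elementary calculus of `φ ∗ α` for `α ∈ C_c^∞(G_∞)`
WITHOUT assuming Harish-Chandra's identity `φ = φ ∗ α` (the tree's
`lieDeriv_eq_integral_of_convolution_eq`, `hasModerateGrowth_lieDeriv_of_convolution_eq` of
`AutomorphicFormsStableConvolution` and `lieDeriv_eq_integral_of_convolution` of
`HarishChandraGrowthGL` are all stated under that identity), as the first brick of a proof of that
identity for CUSP forms by compact operators:

* `continuous_of_isArchSmooth_gl`, `isArchSmooth_comp_inv_gl` — smooth functions on `GL_n(K_∞)`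
  are continuous, and `x ↦ α(x⁻¹)` is smooth with `α`;
* `lieDeriv_archConv` — **`X (φ ∗ α) = φ ∗ (X α)`** (Borel 1997, Prop. 2.3 (1)/Cor. 5.3 (1);
  Moeglin–Waldspurger 1995, Lemma I.2.5 (a)) for `φ` continuous along `G_∞`-orbits, `ν` left
  invariant: by left invariance `(φ ∗ α)(g exp tX) = ∫ φ(g y) α(y⁻¹ exp tX) dν(y)` and one
  differentiates under the integral sign; iterated: `iterLieDeriv_archConv`, `applyFree_archConv`
  (`p (φ ∗ α) = φ ∗ (p α)` for every `p ∈ ℝ⟨𝔤⟩`);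
* `norm_archConv_le` — **the exponent of growth is kept**: `‖φ(g)‖ ≤ C (1 ⊔ ‖g‖)^r` implies
  `‖(φ ∗ α)(g)‖ ≤ C' (1 ⊔ ‖g‖)^r` with the same `r` (MW Lemma I.2.5 (a));
* `archConv_apply_mul_ofInfiniteAdelic` — **`K_∞` commutes with `∗ α` for `Ad K_∞`-invariant `α`**:
  `(φ ∗ α)(g k) = ((r(k) φ) ∗ α)(g)` when `α(k x k⁻¹) = α(x)` and `ν` is left and right invariant
  (Borel 1972, 3.5).

Everything here is proved; the only definition is `archConv`.

## References

* A. Borel, *Automorphic forms on `SL₂(ℝ)`*, Cambridge Tracts in Math. 130 (1997), 2.2–2.3,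
  Prop. 5.2, Cor. 5.3 [Borel1997].
* C. Moeglin, J.-L. Waldspurger, *Spectral decomposition and Eisenstein series* (1995), Lemma
  I.2.5 (a) [MoeglinWaldspurger1995].
* A. Borel, H. Jacquet, *Automorphic forms and automorphic representations*, Proc. Sympos. Pure
  Math. 33 (1979), Part 1, 4.3 (ii) [BorelJacquet1979].
-/

noncomputable section

open scoped MatrixGroups Matrix ContDiff Topology Classical
open Filter Set NumberField NumberField.mixedEmbedding IsDedekindDomain
open _root_.MeasureTheory _root_.MeasureTheory.Measure

namespace Literature.NumberTheory.Automorphic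

-- Mathlib idiom (Mathlib/Algebra/Lie/OfAssociative.lean); needed to mention Lie subalgebras of matrix algebras
attribute [local instance 100] LieRing.ofAssociativeRing

-- `M_n(K ⊗ ℝ)` is finite-dimensional over `ℝ` (the tree's instance, as in `HarishChandraDiracGL`)
attribute [local instance] finiteDimensional_matrix_mixedSpace

-- the measurable structure of `GL_n(K_∞)` (the tree's local instances, as in
-- `HarishChandraConvolutionAdelic`)
attribute [local instance] glInfBorel borelSpace_glInf locallyCompactSpace_glInf
  secondCountableTopology_glInf

variable {n : ℕ} {K : Type} [Field K] [NumberField K]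

/-! ### 1. Smooth functions on `GL_n(K_∞)`: continuity, inversion -/

section Smooth

-- the scoped operator norm on `𝔤𝔩_n(K_∞)`, through which `IsArchSmooth` is defined
open scoped Matrix.Norms.Operator

/-- Every matrix lies in the Lie algebra of `archGroupGL n K` (which is `⊤`); private copy of
`mem_archGroupGL_lie` of `TestFunctionLieDeriv`, which is not imported here. [folklore] -/
private theorem mem_archGroupGL_lie' (M : Matrix (Fin n) (Fin n) (mixedSpace K)) :
    M ∈ (archGroupGL n K).lie := by
  rw [archGroupGL_lie]; exact LieSubalgebra.mem_top M

/-- The slices `M ↦ α (u exp M)` of a function on `GL_n(K_∞)` smooth in the archimedean variable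
are smooth on all matrices. [folklore] -/
theorem contDiff_comp_mul_expGL_of_isArchSmooth {α : GL (Fin n) (mixedSpace K) → ℂ}
    (hα : IsArchSmooth (archGroupGL n K).carrier.subtype α) (u : GL (Fin n) (mixedSpace K)) :
    ContDiff ℝ ∞ fun M : Matrix (Fin n) (Fin n) (mixedSpace K) => α (u * expGL M) := by
  let incl : Matrix (Fin n) (Fin n) (mixedSpace K) →ₗ[ℝ] (archGroupGL n K).lie.toSubmodule :=
    LinearMap.codRestrict (archGroupGL n K).lie.toSubmodule LinearMap.id fun M => mem_archGroupGL_lie' M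
  have hincl : ContDiff ℝ ∞ (incl : Matrix (Fin n) (Fin n) (mixedSpace K) →
      (archGroupGL n K).lie.toSubmodule) :=
    (⟨incl, incl.continuous_of_finiteDimensional⟩ :
      Matrix (Fin n) (Fin n) (mixedSpace K) →L[ℝ] (archGroupGL n K).lie.toSubmodule).contDiff
  exact (hα u).comp hincl

/-- **Smooth functions on `GL_n(K_∞)` are continuous**: a function smooth in the archimedean
variable for the full linear group (`IsArchSmooth` for the inclusion of `archGroupGL`) is
continuous (it is smooth on the open set of invertible matrices,
`contDiffAt_extend_of_isArchSmooth`). [folklore] -/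
theorem continuous_of_isArchSmooth_gl {α : GL (Fin n) (mixedSpace K) → ℂ}
    (hα : IsArchSmooth (archGroupGL n K).carrier.subtype α) : Continuous α := by
  classical
  have hext : ∀ u₀ : GL (Fin n) (mixedSpace K), ContDiffAt ℝ ∞
      (fun M : Matrix (Fin n) (Fin n) (mixedSpace K) => α (if h : IsUnit M then h.unit else 1))
      (u₀ : Matrix (Fin n) (Fin n) (mixedSpace K)) := fun u₀ =>
    contDiffAt_extend_of_isArchSmooth (archGroupGL_lie n K) hα u₀
  have heq : α = (fun M : Matrix (Fin n) (Fin n) (mixedSpace K) =>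
      α (if h : IsUnit M then h.unit else 1)) ∘ Units.val := by
    funext u
    simp only [Function.comp_apply, dif_pos (Units.isUnit u), IsUnit.unit_of_val_units]
  rw [heq]
  exact continuous_iff_continuousAt.2 fun u =>
    (hext u).continuousAt.comp Units.continuous_val.continuousAt

/-- **Inversion preserves smoothness**: if `α` is smooth in the archimedean variable on
`GL_n(K_∞)`, so is `x ↦ α(x⁻¹)`: `α((u exp M)⁻¹) = α(u⁻¹ exp(-u M u⁻¹))`, the composition of the
smooth slice of `α` at `u⁻¹` with a linear map. [folklore] -/
theorem isArchSmooth_comp_inv_gl {α : GL (Fin n) (mixedSpace K) → ℂ}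
    (hα : IsArchSmooth (archGroupGL n K).carrier.subtype α) :
    IsArchSmooth (archGroupGL n K).carrier.subtype fun x => α x⁻¹ := by
  intro u
  -- the conjugation `M ↦ -(u M u⁻¹)`, a continuous linear map
  let c : Matrix (Fin n) (Fin n) (mixedSpace K) →ₗ[ℝ] Matrix (Fin n) (Fin n) (mixedSpace K) :=
    { toFun := fun M => -((u : Matrix (Fin n) (Fin n) (mixedSpace K)) * M *
        ((u⁻¹ : GL (Fin n) (mixedSpace K)) : Matrix (Fin n) (Fin n) (mixedSpace K)))
      map_add' := fun M M' => by simp only [mul_add, add_mul, neg_add]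
      map_smul' := fun t M => by
        simp only [Matrix.mul_smul, Matrix.smul_mul, smul_neg, RingHom.id_apply] }
  have hc : ContDiff ℝ ∞ (c : Matrix (Fin n) (Fin n) (mixedSpace K) →
      Matrix (Fin n) (Fin n) (mixedSpace K)) :=
    (⟨c, c.continuous_of_finiteDimensional⟩ : Matrix (Fin n) (Fin n) (mixedSpace K) →L[ℝ]
      Matrix (Fin n) (Fin n) (mixedSpace K)).contDiff
  have hslice := contDiff_comp_mul_expGL_of_isArchSmooth hα u⁻¹
  -- `(u exp M)⁻¹ = u⁻¹ exp (-(u M u⁻¹))`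
  have key : ∀ M : Matrix (Fin n) (Fin n) (mixedSpace K),
      (u * expGL M)⁻¹ = u⁻¹ * expGL (c M) := by
    intro M
    refine Units.ext ?_
    change (((u * expGL M)⁻¹ : GL (Fin n) (mixedSpace K)) : Matrix (Fin n) (Fin n) (mixedSpace K)) =
      ((u⁻¹ : GL (Fin n) (mixedSpace K)) : Matrix (Fin n) (Fin n) (mixedSpace K)) *
        (expGL (-((u : Matrix (Fin n) (Fin n) (mixedSpace K)) * M *
          ((u⁻¹ : GL (Fin n) (mixedSpace K)) : Matrix (Fin n) (Fin n) (mixedSpace K)))) :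
            Matrix (Fin n) (Fin n) (mixedSpace K))
    rw [mul_inv_rev, Units.val_mul, ← expGL_neg, coe_expGL, coe_expGL]
    have hneg : -((u : Matrix (Fin n) (Fin n) (mixedSpace K)) * M *
        ((u⁻¹ : GL (Fin n) (mixedSpace K)) : Matrix (Fin n) (Fin n) (mixedSpace K))) =
        (u : Matrix (Fin n) (Fin n) (mixedSpace K)) * (-M) *
          ((u⁻¹ : GL (Fin n) (mixedSpace K)) : Matrix (Fin n) (Fin n) (mixedSpace K)) := by
      rw [Matrix.mul_neg, Matrix.neg_mul]
    rw [hneg, Matrix.exp_units_conj u (-M), ← mul_assoc, ← mul_assoc, Units.inv_mul, one_mul]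
  have heq : (fun X : (archGroupGL n K).lie.toSubmodule =>
      (fun x => α x⁻¹) (u * (archGroupGL n K).carrier.subtype
        ((archGroupGL n K).expMem ⟨X, X.2⟩))) =
      (fun M : Matrix (Fin n) (Fin n) (mixedSpace K) => α (u⁻¹ * expGL M)) ∘ c ∘
        (archGroupGL n K).lie.toSubmodule.subtype := by
    funext X
    simp only [Function.comp_apply, Subgroup.coe_subtype, RealMatrixGroup.coe_expMem,
      Submodule.coe_subtype]
    rw [key]
  rw [heq]
  exact (hslice.comp hc).comp (archGroupGL n K).lie.toSubmodule.subtypeL.contDiff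

/-- `exp (0 · X) = 1` in `GL_n(K_∞)`. [folklore] -/
theorem coe_expMem_zero_smul_gl (X : (archGroupGL n K).lie) :
    ((archGroupGL n K).expMem ((0 : ℝ) • X) : GL (Fin n) (mixedSpace K)) = 1 := by
  rw [RealMatrixGroup.coe_expMem]
  have h0 : (((0 : ℝ) • X : (archGroupGL n K).lie) : Matrix (Fin n) (Fin n) (mixedSpace K)) = 0 := by
    change (0 : ℝ) • (X : Matrix (Fin n) (Fin n) (mixedSpace K)) = 0
    exact zero_smul _ _
  rw [h0, expGL_zero]


/-- The Lie derivative of a compactly supported function on `GL_n(K_∞)` is compactly supported (its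
support lies in that of the function: off `supp α` the curve `t ↦ y exp tX` stays outside for
small `t`). [folklore] -/
theorem hasCompactSupport_lieDeriv_glInf {α : GL (Fin n) (mixedSpace K) → ℂ} (hαs : HasCompactSupport α)
    (X : (archGroupGL n K).lie) :
    HasCompactSupport (lieDeriv (archGroupGL n K).carrier.subtype X α) := by
  refine HasCompactSupport.intro' (K := tsupport α) hαs (isClosed_tsupport α) fun y hy => ?_
  have hcont : Continuous fun t : ℝ =>
      y * ((archGroupGL n K).expMem (t • X) : GL (Fin n) (mixedSpace K)) :=
    continuous_const.mul (continuous_subtype_val.comp (continuous_expMem_smul X))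
  have hev : (fun t : ℝ => α (y * ((archGroupGL n K).expMem (t • X) : GL (Fin n) (mixedSpace K))))
      =ᶠ[𝓝 0] fun _ => (0 : ℂ) := by
    have hopen : IsOpen (tsupport α)ᶜ := (isClosed_tsupport α).isOpen_compl
    have hy0 : (fun t : ℝ => y * ((archGroupGL n K).expMem (t • X) : GL (Fin n) (mixedSpace K))) 0 ∈
        (tsupport α)ᶜ := by
      change y * ((archGroupGL n K).expMem ((0 : ℝ) • X) : GL (Fin n) (mixedSpace K)) ∈ (tsupport α)ᶜ
      rwa [coe_expMem_zero_smul_gl, mul_one]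
    filter_upwards [hcont.continuousAt.eventually_mem (hopen.mem_nhds hy0)] with t ht
    exact image_eq_zero_of_notMem_tsupport ht
  change deriv (fun t : ℝ =>
    α (y * ((archGroupGL n K).expMem (t • X) : GL (Fin n) (mixedSpace K)))) 0 = 0
  rw [hev.deriv_eq]
  exact deriv_const 0 0

/-- Iterated Lie derivatives of a smooth function on `GL_n(K_∞)` are smooth
(`isArchSmooth_lieDeriv_of_lie_eq_top`, by induction). [folklore] -/
theorem isArchSmooth_iterLieDeriv_glInf {α : GL (Fin n) (mixedSpace K) → ℂ}
    (hα : IsArchSmooth (archGroupGL n K).carrier.subtype α) :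
    ∀ w : List (archGroupGL n K).lie,
      IsArchSmooth (archGroupGL n K).carrier.subtype (iterLieDeriv (archGroupGL n K).carrier.subtype w α)
  | [] => hα
  | X :: w => by
    rw [iterLieDeriv_cons]
    exact isArchSmooth_lieDeriv_of_lie_eq_top (archGroupGL n K).carrier.subtype (archGroupGL_lie n K) X
      (isArchSmooth_iterLieDeriv_glInf hα w)

/-- Iterated Lie derivatives of a compactly supported smooth function on `GL_n(K_∞)` are
compactly supported. [folklore] -/
theorem hasCompactSupport_iterLieDeriv_glInf {α : GL (Fin n) (mixedSpace K) → ℂ}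
    (hαs : HasCompactSupport α) :
    ∀ w : List (archGroupGL n K).lie,
      HasCompactSupport (iterLieDeriv (archGroupGL n K).carrier.subtype w α)
  | [] => hαs
  | X :: w => by
    rw [iterLieDeriv_cons]
    exact hasCompactSupport_lieDeriv_glInf (hasCompactSupport_iterLieDeriv_glInf hαs w) X


end Smooth

/-! ### 2. The right convolution `φ ∗ α` and its Lie derivatives -/

section Conv

variable (ν : Measure (GL (Fin n) (mixedSpace K)))

/-- **Borel's right convolution** of a function `φ` on `GL_n(𝔸_K)` by a weight `α` on
`G_∞ = GL_n(K_∞)` with respect to the measure `ν` on `G_∞`: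
`(φ ∗ α)(g) = ∫_{G_∞} φ(g x) α(x⁻¹) dν(x)` (Bochner integral, junk `0` where not integrable).
Borel 1997, 2.2 (`(f ∗ α)(x) = ∫ f(xy) α(y⁻¹) dy`). [cite: Borel1997, 2.2] -/
def archConv (α : GL (Fin n) (mixedSpace K) → ℂ) (φ : (AdelicGroupData.gl n K).Adelic → ℂ) :
    (AdelicGroupData.gl n K).Adelic → ℂ :=
  fun g => ∫ y, φ (g * GLn.ofInfiniteAdelic n K y) * α y⁻¹ ∂ν

/-- Unfolding of `archConv`. [cite: Borel1997, 2.2] -/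
theorem archConv_apply (α : GL (Fin n) (mixedSpace K) → ℂ) (φ : (AdelicGroupData.gl n K).Adelic → ℂ)
    (g : (AdelicGroupData.gl n K).Adelic) :
    archConv ν α φ g = ∫ y, φ (g * GLn.ofInfiniteAdelic n K y) * α y⁻¹ ∂ν := rfl

/-- `φ ∗ α` in the "`∫ φ(g x) β(x) dx`" form: `archConv ν (β ∘ inv) φ g = ∫ φ(g x) β(x) dν(x)`.
[cite: Borel1997, 2.2] -/
theorem archConv_comp_inv_apply (β : GL (Fin n) (mixedSpace K) → ℂ)
    (φ : (AdelicGroupData.gl n K).Adelic → ℂ) (g : (AdelicGroupData.gl n K).Adelic) :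
    archConv ν (fun x => β x⁻¹) φ g = ∫ y, φ (g * GLn.ofInfiniteAdelic n K y) * β y ∂ν := by
  simp only [archConv_apply, inv_inv]

/-- `φ ∗ α` is additive in the weight, on weights whose integrands are integrable. [folklore] -/
theorem archConv_add_weight {α β : GL (Fin n) (mixedSpace K) → ℂ}
    {φ : (AdelicGroupData.gl n K).Adelic → ℂ} (g : (AdelicGroupData.gl n K).Adelic)
    (hα : Integrable (fun y => φ (g * GLn.ofInfiniteAdelic n K y) * α y⁻¹) ν)
    (hβ : Integrable (fun y => φ (g * GLn.ofInfiniteAdelic n K y) * β y⁻¹) ν) :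
    archConv ν (α + β) φ g = archConv ν α φ g + archConv ν β φ g := by
  simp only [archConv_apply, Pi.add_apply, mul_add]
  exact integral_add hα hβ

/-- `φ ∗ (c α) = c (φ ∗ α)`. [folklore] -/
theorem archConv_smul_weight (c : ℂ) (α : GL (Fin n) (mixedSpace K) → ℂ)
    (φ : (AdelicGroupData.gl n K).Adelic → ℂ) (g : (AdelicGroupData.gl n K).Adelic) :
    archConv ν (c • α) φ g = c * archConv ν α φ g := by
  simp only [archConv_apply, Pi.smul_apply, smul_eq_mul, ← integral_const_mul]
  congr 1 with y
  ring

/-- The integrand of `φ ∗ α` at `g` is integrable when `φ` is continuous along the `G_∞`-orbit of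
`g` and `α` is continuous with compact support. [folklore] -/
theorem integrable_archConv_integrand [IsFiniteMeasureOnCompacts ν]
    {φ : (AdelicGroupData.gl n K).Adelic → ℂ} {g : (AdelicGroupData.gl n K).Adelic}
    (hφ : Continuous fun y : GL (Fin n) (mixedSpace K) => φ (g * GLn.ofInfiniteAdelic n K y))
    {α : GL (Fin n) (mixedSpace K) → ℂ} (hαc : Continuous α) (hαs : HasCompactSupport α) :
    Integrable (fun y => φ (g * GLn.ofInfiniteAdelic n K y) * α y⁻¹) ν := by
  refine (hφ.mul (hαc.comp continuous_inv)).integrable_of_hasCompactSupport ?_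
  exact (hαs.comp_homeomorph (Homeomorph.inv (GL (Fin n) (mixedSpace K)))).mul_left

variable {hcpt : isCompact_glFiniteIntegralLevel n K}

-- the scoped operator norm on `𝔤𝔩_n(K_∞)`, through which `IsArchSmooth` is defined
set_option maxHeartbeats 800000 in
set_option backward.isDefEq.respectTransparency false in
open scoped Matrix.Norms.Operator in
/-- **The Lie derivative of a convolution is the convolution with the derived weight**,
`X (φ ∗ α) = φ ∗ (X α)` (Borel 1997, 2.3 (1) and Cor. 5.3 (1): `D(f ∗ α) = f ∗ Dα`;
Moeglin–Waldspurger 1995, Lemma I.2.5 (a)), for `φ : GL_n(𝔸_K) → ℂ` continuous along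
`G_∞`-orbits, `ν` a left invariant measure on `GL_n(K_∞)` finite on compacta and
`α ∈ C_c^∞(GL_n(K_∞))`: by left invariance `(φ ∗ α)(g exp tX) = ∫ φ(g y) α(y⁻¹ exp tX) dν(y)`, the
integrand has `t`-derivative `φ(g y) (Xα)(y⁻¹ exp tX)` (`IsArchSmooth.hasDerivAt_flow`), dominated on
`|t| < 1` by a continuous compactly supported function, and one differentiates under the integral
sign. Unlike the tree's `lieDeriv_eq_integral_of_convolution_eq` no identity `φ = φ ∗ α` is assumed.
[cite: Borel1997, 2.3 (1) and Cor. 5.3] -/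
theorem lieDeriv_archConv [ν.IsMulLeftInvariant] [IsFiniteMeasureOnCompacts ν]
    {φ : (AdelicGroupData.gl n K).Adelic → ℂ}
    (hφ : ∀ g, Continuous fun y : GL (Fin n) (mixedSpace K) => φ (g * GLn.ofInfiniteAdelic n K y))
    {α : GL (Fin n) (mixedSpace K) → ℂ} (hαs : HasCompactSupport α)
    (hα : IsArchSmooth (archGroupGL n K).carrier.subtype α) (X : (archGroupGL n K).lie)
    (g : (AdelicGroupData.gl n K).Adelic) :
    lieDeriv (AutomorphyDatum.gl n K hcpt).ofArch X (archConv ν α φ) g =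
      archConv ν (lieDeriv (archGroupGL n K).carrier.subtype X α) φ g := by
  set αX : GL (Fin n) (mixedSpace K) → ℂ := lieDeriv (archGroupGL n K).carrier.subtype X α with hαX_def
  have hαc : Continuous α := continuous_of_isArchSmooth_gl hα
  have hαXsm : IsArchSmooth (archGroupGL n K).carrier.subtype αX :=
    isArchSmooth_lieDeriv_of_lie_eq_top (archGroupGL n K).carrier.subtype (archGroupGL_lie n K) X hα
  have hαXc : Continuous αX := continuous_of_isArchSmooth_gl hαXsm
  have hαXs : HasCompactSupport αX := hasCompactSupport_lieDeriv_glInf hαs X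
  have hφg : Continuous fun y : GL (Fin n) (mixedSpace K) => φ (g * GLn.ofInfiniteAdelic n K y) :=
    hφ g
  have hexpc : Continuous fun t : ℝ => ((archGroupGL n K).expMem (t • X) : GL (Fin n) (mixedSpace K)) :=
    continuous_subtype_val.comp (continuous_expMem_smul X)
  -- the parametrised integrand and its derivative
  set F : ℝ → GL (Fin n) (mixedSpace K) → ℂ := fun t y =>
    φ (g * GLn.ofInfiniteAdelic n K y) * α (y⁻¹ * ((archGroupGL n K).expMem (t • X) : GL (Fin n) (mixedSpace K)))
    with hF_def
  set F' : ℝ → GL (Fin n) (mixedSpace K) → ℂ := fun t y =>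
    φ (g * GLn.ofInfiniteAdelic n K y) * αX (y⁻¹ * ((archGroupGL n K).expMem (t • X) : GL (Fin n) (mixedSpace K)))
    with hF'_def
  -- `(φ ∗ α)(g exp tX) = ∫ F t`, by left invariance of `ν`
  have hFt : ∀ t : ℝ, archConv ν α φ (g * (AutomorphyDatum.gl n K hcpt).ofArch ((archGroupGL n K).expMem (t • X))) =
      ∫ y, F t y ∂ν := by
    intro t
    rw [archConv_apply, hF_def]
    dsimp only
    conv_rhs => rw [← integral_mul_left_eq_self _ ((archGroupGL n K).expMem (t • X) : GL (Fin n) (mixedSpace K))]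
    congr 1 with y
    rw [AutomorphyDatum.gl_ofArch_apply, map_mul, ← mul_assoc, mul_inv_rev, inv_mul_cancel_right]
    rfl
  -- continuity of `F t`, `F' t` in `y`
  have hFc : ∀ t, Continuous (F t) := fun t =>
    hφg.mul (hαc.comp (continuous_inv.mul continuous_const))
  have hF'c : ∀ t, Continuous (F' t) := fun t =>
    hφg.mul (hαXc.comp (continuous_inv.mul continuous_const))
  -- a compact set carrying the supports of all `F' t`, `|t| ≤ 1`
  set S : Set (GL (Fin n) (mixedSpace K)) :=
    (fun p : ℝ × GL (Fin n) (mixedSpace K) =>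
      ((archGroupGL n K).expMem (p.1 • X) : GL (Fin n) (mixedSpace K)) * p.2⁻¹) '' (Set.Icc (-1) 1 ×ˢ tsupport αX)
    with hS_def
  have hS : IsCompact S :=
    (isCompact_Icc.prod hαXs.isCompact).image ((hexpc.comp continuous_fst).mul continuous_snd.inv)
  obtain ⟨M, hM⟩ := hαXs.exists_bound_of_continuous hαXc
  set bound : GL (Fin n) (mixedSpace K) → ℝ :=
    S.indicator fun y => ‖φ (g * GLn.ofInfiniteAdelic n K y)‖ * M with hbound_def
  have hsupp : ∀ t ∈ Metric.ball (0 : ℝ) 1, ∀ y, ‖F' t y‖ ≤ bound y := by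
    intro t ht y
    rw [hF'_def, hbound_def]
    dsimp only
    by_cases hy : y ∈ S
    · rw [Set.indicator_of_mem hy, norm_mul]
      exact mul_le_mul_of_nonneg_left (hM _) (norm_nonneg _)
    · -- off `S` the derived weight vanishes
      have hzero : αX (y⁻¹ * ((archGroupGL n K).expMem (t • X) : GL (Fin n) (mixedSpace K))) = 0 := by
        by_contra hne
        apply hy
        refine ⟨(t, y⁻¹ * ((archGroupGL n K).expMem (t • X) : GL (Fin n) (mixedSpace K))),
          ⟨?_, subset_tsupport _ hne⟩, ?_⟩
        · rw [Metric.mem_ball, dist_zero_right, Real.norm_eq_abs, abs_lt] at ht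
          exact ⟨ht.1.le, ht.2.le⟩
        · dsimp only
          rw [mul_inv_rev, inv_inv, mul_inv_cancel_left]
      rw [hzero, mul_zero, norm_zero, Set.indicator_of_notMem hy]
  have hbound_int : Integrable bound ν := by
    rw [hbound_def]
    exact ((hφg.norm.mul continuous_const).continuousOn.integrableOn_compact
      hS).integrable_indicator hS.measurableSet
  have hF0_int : Integrable (F 0) ν := by
    refine (hFc 0).integrable_of_hasCompactSupport ?_
    refine HasCompactSupport.mul_left ?_
    have h1 : (fun y : GL (Fin n) (mixedSpace K) =>
        α (y⁻¹ * ((archGroupGL n K).expMem ((0 : ℝ) • X) : GL (Fin n) (mixedSpace K)))) =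
        α ∘ (Homeomorph.inv (GL (Fin n) (mixedSpace K))) := by
      funext y
      rw [coe_expMem_zero_smul_gl, mul_one]
      rfl
    rw [h1]
    exact hαs.comp_homeomorph _
  have hdiff : ∀ y, ∀ t ∈ Metric.ball (0 : ℝ) 1, HasDerivAt (F · y) (F' t y) t := by
    intro y t _
    have h := hα.hasDerivAt_flow (archGroupGL n K).carrier.subtype X y⁻¹ t
    simp only [Subgroup.coe_subtype] at h
    exact h.const_mul (φ (g * GLn.ofInfiniteAdelic n K y))
  -- differentiate under the integral sign at `t = 0`
  have hmain := hasDerivAt_integral_of_dominated_loc_of_deriv_le (μ := ν) (F := F) (F' := F')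
    (x₀ := (0 : ℝ)) (bound := bound) (Metric.ball_mem_nhds (0 : ℝ) one_pos)
    (Eventually.of_forall fun t => (hFc t).aestronglyMeasurable) hF0_int
    ((hF'c 0).aestronglyMeasurable) (Eventually.of_forall fun y t ht => hsupp t ht y) hbound_int
    (Eventually.of_forall hdiff)
  -- identify the derivative at `0` with the Lie derivative
  have hdef : lieDeriv (AutomorphyDatum.gl n K hcpt).ofArch X (archConv ν α φ) g =
      deriv (fun t : ℝ => archConv ν α φ
        (g * (AutomorphyDatum.gl n K hcpt).ofArch ((archGroupGL n K).expMem (t • X)))) 0 := rfl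
  have hcurve : (fun t : ℝ => archConv ν α φ
      (g * (AutomorphyDatum.gl n K hcpt).ofArch ((archGroupGL n K).expMem (t • X)))) = fun t => ∫ y, F t y ∂ν :=
    funext hFt
  rw [hdef, hcurve, hmain.2.deriv, hF'_def, archConv_apply]
  congr 1 with y
  dsimp only
  rw [coe_expMem_zero_smul_gl, mul_one]

/-- **Iterated: `X₁ ⋯ X_m (φ ∗ α) = φ ∗ (X₁ ⋯ X_m α)`** (Borel 1997, Cor. 5.3 (1), by induction on the
word). [cite: Borel1997, Cor. 5.3] -/
theorem iterLieDeriv_archConv [ν.IsMulLeftInvariant] [IsFiniteMeasureOnCompacts ν]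
    {φ : (AdelicGroupData.gl n K).Adelic → ℂ}
    (hφ : ∀ g, Continuous fun y : GL (Fin n) (mixedSpace K) => φ (g * GLn.ofInfiniteAdelic n K y))
    {α : GL (Fin n) (mixedSpace K) → ℂ} (hαs : HasCompactSupport α)
    (hα : IsArchSmooth (archGroupGL n K).carrier.subtype α) :
    ∀ w : List (archGroupGL n K).lie,
      iterLieDeriv (AutomorphyDatum.gl n K hcpt).ofArch w (archConv ν α φ) =
        archConv ν (iterLieDeriv (archGroupGL n K).carrier.subtype w α) φ
  | [] => rfl
  | X :: w => by
    funext g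
    change lieDeriv (AutomorphyDatum.gl n K hcpt).ofArch X
        (iterLieDeriv (AutomorphyDatum.gl n K hcpt).ofArch w (archConv ν α φ)) g =
      archConv ν (lieDeriv (archGroupGL n K).carrier.subtype X
        (iterLieDeriv (archGroupGL n K).carrier.subtype w α)) φ g
    rw [iterLieDeriv_archConv hφ hαs hα w]
    exact lieDeriv_archConv ν hφ (hasCompactSupport_iterLieDeriv_glInf hαs w)
      (isArchSmooth_iterLieDeriv_glInf hα w) X g

/-- `φ ∗ (∑ c_w α_w) = ∑ c_w (φ ∗ α_w)` for finitely many continuous compactly supported weights.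
[folklore] -/
theorem archConv_finset_sum_smul [IsFiniteMeasureOnCompacts ν] {J : Type*} (s : Finset J)
    (c : J → ℂ) {α : J → GL (Fin n) (mixedSpace K) → ℂ} (hαc : ∀ j, Continuous (α j))
    (hαs : ∀ j, HasCompactSupport (α j)) {φ : (AdelicGroupData.gl n K).Adelic → ℂ}
    {g : (AdelicGroupData.gl n K).Adelic}
    (hφ : Continuous fun y : GL (Fin n) (mixedSpace K) => φ (g * GLn.ofInfiniteAdelic n K y)) :
    archConv ν (∑ j ∈ s, c j • α j) φ g = ∑ j ∈ s, c j * archConv ν (α j) φ g := by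
  classical
  induction s using Finset.induction_on with
  | empty =>
    simp only [Finset.sum_empty, archConv_apply, Pi.zero_apply, mul_zero, integral_zero]
  | insert j s hj ih =>
    rw [Finset.sum_insert hj, Finset.sum_insert hj, ← ih, ← archConv_smul_weight]
    refine archConv_add_weight ν g ?_ ?_
    · have h_eq : (fun y => φ (g * GLn.ofInfiniteAdelic n K y) * (c j • α j) y⁻¹) =
          fun y => c j * (φ (g * GLn.ofInfiniteAdelic n K y) * α j y⁻¹) := by
        funext y; simp only [Pi.smul_apply, smul_eq_mul]; ring
      rw [h_eq]
      exact (integrable_archConv_integrand ν hφ (hαc j) (hαs j)).const_mul (c j)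
    · have : (fun y => φ (g * GLn.ofInfiniteAdelic n K y) * (∑ i ∈ s, c i • α i) y⁻¹) =
          fun y => ∑ i ∈ s, c i * (φ (g * GLn.ofInfiniteAdelic n K y) * α i y⁻¹) := by
        funext y
        simp only [Finset.sum_apply, Pi.smul_apply, smul_eq_mul, Finset.mul_sum]
        exact Finset.sum_congr rfl fun i _ => by ring
      rw [this]
      exact integrable_finsetSum _ fun i _ =>
        (integrable_archConv_integrand ν hφ (hαc i) (hαs i)).const_mul (c i)

/-- **`p (φ ∗ α) = φ ∗ (p α)` for every `p ∈ ℝ⟨𝔤⟩`** (every non-commutative polynomial in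
`𝔤 = 𝔤𝔩_n(K_∞)` acting by iterated Lie derivatives): all derivatives of `φ ∗ α` fall on the weight.
Borel 1997, Cor. 5.3 (1); Moeglin–Waldspurger 1995, Lemma I.2.5 (a) (`δ(X) δ(f) φ = δ(Xf) φ`).
[cite: Borel1997, Cor. 5.3] -/
theorem applyFree_archConv [ν.IsMulLeftInvariant] [IsFiniteMeasureOnCompacts ν]
    {φ : (AdelicGroupData.gl n K).Adelic → ℂ}
    (hφ : ∀ g, Continuous fun y : GL (Fin n) (mixedSpace K) => φ (g * GLn.ofInfiniteAdelic n K y))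
    {α : GL (Fin n) (mixedSpace K) → ℂ} (hαs : HasCompactSupport α)
    (hα : IsArchSmooth (archGroupGL n K).carrier.subtype α) (p : FreeAlgebra ℝ (archGroupGL n K).lie)
    (g : (AdelicGroupData.gl n K).Adelic) :
    applyFree (AutomorphyDatum.gl n K hcpt).ofArch p (archConv ν α φ) g =
      archConv ν (applyFree (archGroupGL n K).carrier.subtype p α) φ g := by
  -- both sides are the same finite sum over the word basis
  change (∑ w ∈ ((FreeAlgebra.basisFreeMonoid ℝ (archGroupGL n K).lie).repr p).support,
      (((FreeAlgebra.basisFreeMonoid ℝ (archGroupGL n K).lie).repr p w : ℝ) : ℂ) •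
        iterLieDeriv (AutomorphyDatum.gl n K hcpt).ofArch (FreeMonoid.toList w) (archConv ν α φ)) g =
    archConv ν (∑ w ∈ ((FreeAlgebra.basisFreeMonoid ℝ (archGroupGL n K).lie).repr p).support,
      (((FreeAlgebra.basisFreeMonoid ℝ (archGroupGL n K).lie).repr p w : ℝ) : ℂ) •
        iterLieDeriv (archGroupGL n K).carrier.subtype (FreeMonoid.toList w) α) φ g
  rw [archConv_finset_sum_smul ν _ _
    (fun w => continuous_of_isArchSmooth_gl (isArchSmooth_iterLieDeriv_glInf hα _))
    (fun w => hasCompactSupport_iterLieDeriv_glInf hαs _) (hφ g)]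
  simp only [Finset.sum_apply, Pi.smul_apply, smul_eq_mul]
  refine Finset.sum_congr rfl fun w _ => ?_
  rw [iterLieDeriv_archConv ν hφ hαs hα]
  rfl

/-- **The exponent of growth is kept by `∗ α`** (Moeglin–Waldspurger 1995, Lemma I.2.5 (a): "Let
`φ` be a function having moderate growth. Then `δ(f)φ` has moderate growth"; Borel 1997, Prop. 5.2):
if `‖φ(h)‖ ≤ C (1 ⊔ ‖h‖)^r` for all `h` and `α` is continuous with compact support, then
`‖(φ ∗ α)(g)‖ ≤ C' (1 ⊔ ‖g‖)^r` for all `g`, with the SAME `r`: the integrand lives on the compact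
`S = (supp α)⁻¹`, where `1 ⊔ ‖g x‖ ≤ (1 ⊔ n B)(1 ⊔ ‖g‖)` (`one_sup_adelicHeightGL_mul_le`, `B` a bound
of the height on `S`). [cite: MoeglinWaldspurger1995, Lemma I.2.5 (a)] -/
theorem norm_archConv_le [IsFiniteMeasureOnCompacts ν] {φ : (AdelicGroupData.gl n K).Adelic → ℂ}
    {C : ℝ} {r : ℕ} (hCr : ∀ h, ‖φ h‖ ≤ C * (1 ⊔ adelicHeightGL n K h) ^ r)
    {α : GL (Fin n) (mixedSpace K) → ℂ} (hαc : Continuous α) (hαs : HasCompactSupport α) :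
    ∃ C' : ℝ, ∀ g, ‖archConv ν α φ g‖ ≤ C' * (1 ⊔ adelicHeightGL n K g) ^ r := by
  -- the compact set carrying the integrand, and the height bound on it
  set S : Set (GL (Fin n) (mixedSpace K)) := (tsupport α)⁻¹ with hS_def
  have hS : IsCompact S := hαs.isCompact.inv
  obtain ⟨B, hB0, hB⟩ := exists_adelicHeightGL_ofInfinite_le_of_isCompact (n := n) (K := K) hS
  obtain ⟨M, hM⟩ := hαs.exists_bound_of_continuous hαc
  have hM0 : 0 ≤ M := (norm_nonneg _).trans (hM 1)
  have hC0 : 0 ≤ C := by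
    have h := hCr 1
    have hpos : (0 : ℝ) < (1 ⊔ adelicHeightGL n K 1) ^ r :=
      pow_pos (lt_of_lt_of_le one_pos le_sup_left) r
    exact nonneg_of_mul_nonneg_left ((norm_nonneg _).trans h) hpos
  set D : ℝ := 1 ⊔ n * B with hD_def
  have hD0 : 0 ≤ D := le_trans zero_le_one le_sup_left
  refine ⟨C * D ^ r * M * ν.real S, fun g => ?_⟩
  have hg1 : (0 : ℝ) < 1 ⊔ adelicHeightGL n K g := lt_of_lt_of_le one_pos le_sup_left
  set c : ℝ := C * (D * (1 ⊔ adelicHeightGL n K g)) ^ r * M with hc_def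
  -- pointwise bound of the integrand
  have hptw : ∀ x, ‖φ (g * GLn.ofInfiniteAdelic n K x) * α x⁻¹‖ ≤ S.indicator (fun _ => c) x := by
    intro x
    by_cases hx : x ∈ S
    · rw [Set.indicator_of_mem hx, norm_mul, hc_def]
      refine mul_le_mul ?_ (hM _) (norm_nonneg _) (by positivity)
      refine (hCr _).trans (mul_le_mul_of_nonneg_left ?_ hC0)
      refine pow_le_pow_left₀ (le_trans zero_le_one le_sup_left) ?_ r
      refine (one_sup_adelicHeightGL_mul_le g _).trans (mul_le_mul_of_nonneg_right ?_ hg1.le)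
      exact sup_le_sup_left (mul_le_mul_of_nonneg_left (hB x hx) (Nat.cast_nonneg n)) _
    · have hx' : x⁻¹ ∉ tsupport α := fun h => hx (by rw [hS_def, Set.mem_inv]; exact h)
      rw [image_eq_zero_of_notMem_tsupport hx', mul_zero, norm_zero, Set.indicator_of_notMem hx]
  -- integrate
  rw [archConv_apply]
  refine (norm_integral_le_integral_norm _).trans ?_
  have hconst : Integrable (S.indicator fun _ : GL (Fin n) (mixedSpace K) => c) ν :=
    (integrableOn_const (C := c) (hs := hS.measure_lt_top.ne)).integrable_indicator hS.measurableSet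
  refine (integral_mono_of_nonneg (Eventually.of_forall fun x => norm_nonneg _) hconst
    (Eventually.of_forall hptw)).trans ?_
  rw [integral_indicator_const _ hS.measurableSet, smul_eq_mul, hc_def, mul_pow]
  have : ν.real S * (C * (D ^ r * (1 ⊔ adelicHeightGL n K g) ^ r) * M) =
      C * D ^ r * M * ν.real S * (1 ⊔ adelicHeightGL n K g) ^ r := by ring
  rw [this]


set_option maxHeartbeats 800000 in
set_option backward.isDefEq.respectTransparency false in
/-- **`K_∞` commutes with `∗ α` for `Ad`-invariant weights** (Borel 1972, 3.5: `π(f)` commutes with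
`K` for `Int K`-invariant `f`; Harish-Chandra 1966, §8): if `α(k x k⁻¹) = α(x)` for all `x` and `ν` is
left and right invariant, then `(φ ∗ α)(g k) = ((r(k) φ) ∗ α)(g)`, where `r(k) φ = φ(· k)`:
substitute `x ↦ k x k⁻¹` in `∫ φ(g x k) α(x⁻¹) dν(x)`. [cite: Borel1972, 3.5] -/
theorem archConv_apply_mul_ofInfiniteAdelic [ν.IsMulLeftInvariant] [ν.IsMulRightInvariant]
    (k : GL (Fin n) (mixedSpace K)) {α : GL (Fin n) (mixedSpace K) → ℂ}
    (hαk : ∀ x, α (k * x * k⁻¹) = α x) (φ : (AdelicGroupData.gl n K).Adelic → ℂ)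
    (g : (AdelicGroupData.gl n K).Adelic) :
    archConv ν α φ (g * GLn.ofInfiniteAdelic n K k) =
      archConv ν α (fun h => φ (h * GLn.ofInfiniteAdelic n K k)) g := by
  simp only [archConv_apply]
  -- substitute `x ↦ k x k⁻¹` on the right
  have h1 := integral_mul_left_eq_self (μ := ν)
    (fun x => φ (g * GLn.ofInfiniteAdelic n K (x * k⁻¹) * GLn.ofInfiniteAdelic n K k) *
      α (x * k⁻¹)⁻¹) k
  have h2 := integral_mul_right_eq_self (μ := ν)
    (fun x => φ (g * GLn.ofInfiniteAdelic n K x * GLn.ofInfiniteAdelic n K k) * α x⁻¹) k⁻¹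
  rw [← h2, ← h1]
  congr 1 with x
  have hinv : (k * x * k⁻¹)⁻¹ = k * x⁻¹ * k⁻¹ := by
    simp only [mul_inv_rev, inv_inv, mul_assoc]
  rw [hinv, hαk, map_mul, map_mul, map_inv]
  congr 2
  simp only [mul_assoc, inv_mul_cancel, mul_one]


end Conv


end Literature.NumberTheory.Automorphic
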